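import Mathlib
import HarnessLib
import Literature.Analysis.FluidPDE.SelfSimilar
import Literature.Analysis.FluidPDE.LocalTypeI
import Literature.Analysis.FluidPDE.VectorCalculus
import Literature.Analysis.FluidPDE.AxisymmetricEuler
import Literature.Analysis.FluidPDE.AxisymmetricVorticityTransport
import Literature.Analysis.FluidPDE.CurlIsometryCovariance
import Literature.Analysis.UnboundedOperators.HeatKernel
import Summits.NavierStokesRegularity.NavierStokesRegularity.Theorems.LocalSineTubeDoorProfileAlignedWindowRigidityAncient
import Summits.NavierStokesRegularity.NavierStokesRegularity.Theorems.PoloidalWindowDoorPoloidalWindowRigidityRotate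
import Summits.NavierStokesRegularity.NavierStokesRegularity.Theorems.PoloidalWindowDoorPoloidalWindowRigidityAxisymmetric
import Summits.NavierStokesRegularity.NavierStokesRegularity.Theorems.PoloidalWindowDoorPoloidalWindowRigidityStrata
import Summits.NavierStokesRegularity.NavierStokesRegularity.Theorems.PoloidalWindowDoorPoloidalWindowRigidityOneSlice
import Summits.NavierStokesRegularity.NavierStokesRegularity.Theorems.PoloidalWindowDoorPoloidalWindowRigidityAnyAxis
import Summits.NavierStokesRegularity.NavierStokesRegularity.Theorems.PoloidalWindowDoorPoloidalWindowRigidityFlat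
import Summits.NavierStokesRegularity.NavierStokesRegularity.Theorems.PoloidalWindowDoorPoloidalWindowRigidityScrewKinematics
import Summits.NavierStokesRegularity.NavierStokesRegularity.Theorems.PoloidalWindowDoorPoloidalWindowRigidityScrewPressure
import Summits.NavierStokesRegularity.NavierStokesRegularity.Theorems.PoloidalWindowDoorPoloidalWindowRigidityDecayingSlopeLiouville
import Summits.NavierStokesRegularity.NavierStokesRegularity.Theorems.PoloidalWindowDoorPoloidalWindowRigidityScrewAssembly

/-!
# Route `PoloidalWindowDoor`, crux `PoloidalWindowRigidity` (K2, stmt-NavierStokesRegularity-19708), line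
# `slicesharp-screw` — the screw-symmetric stratum about an ARBITRARY axis (any direction, any centre, any pitch)

Cell ns-regularity-ideate, seat ns-poloidal-K2-p2 (stub-worker; WAVE 2 item (W2-a) of the K2 lead; lands
`--supports` the crux, `--as helper`).  The registered stub S1 `stub_screwStratum` of the lead's skeleton (tree:
`…ScrewAssembly.screwStratum_of_L2_L3_L4` fed with the landed stubs L2 `…ScrewKinematics`, L3 `…ScrewPressure`,
L4 `…DecayingSlopeLiouville`) empties the stratum of profiles invariant under the screw motions about a VERTICAL axis
(parallel to the poloidal direction `e₃`).  A TILTED axis is pure kinematics, exactly as for the axisymmetric stratum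
(`…AnyAxis`): if ONE slice `v(s)` is invariant under the screw motions `y ↦ c + R_{d,κa}(y − c) + a d` of pitch `κ`
about an axis of direction `d ∦ e₃`, then its vorticity — a screw-equivariant field (`curl_screw`) orthogonal to the
fixed vector `e₃` — is, at every point, orthogonal to every rotate `R_{d,θ} e₃`: for `κ ≠ 0` the angles `θ = κa`
sweep `ℝ`, so the vorticity is parallel to `d` everywhere (`cross_single_two_eq_zero_of_forall_rotZ`, in the frame
of the axis), i.e. UNIDIRECTIONAL, and the rank-one stratum `…Strata.eq_zero_of_aligned` kills the profile; for
`κ = 0` the slice is invariant under the translations along `d` and `…OneSlice.eq_zero_of_translate_eq_slice` does.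

* `cross_single_two_eq_zero_of_forall_rotZ` — `⟪R_θ W, e'⟫ = 0` for all `θ`, `e'` with nonzero horizontal part
  ⇒ `W × e₃ = 0`;
* `fderiv_screw`, `curl_screw` — for a differentiable field invariant under ONE screw motion
  `S : y ↦ c + R_θ(y − c) + a e₃` (`w ∘ S = R_θ ∘ w`): `Dw(S y) = R_θ ∘ Dw(y) ∘ R_{−θ}` and `curl w (S y) = R_θ (curl w y)`;
* `eq_zero_of_screw_tiltedAxis_slice` — class + poloidal along `e₃` + ONE slice screw-invariant (any pitch) about an
  axis `c + L(ℝe₃)` with `L⁻¹e₃ ∦ e₃` ⇒ `v ≡ 0`;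
* `eq_zero_of_screw_anyAxis` / `nonflatLiouville_of_screw_anyAxis` — class + poloidal along `e₃` + EVERY slice
  screw-invariant (one pitch `κ`, any value incl. `0`) about one axis `c + L(ℝe₃)` (ANY `L`) ⇒ `v ≡ 0`, hence not
  backward-singular: the tilted case by the above, the vertical case by S1 in the frame of the axis
  (`…Rotate.class_conj_linearIsometryEquiv`, `…Axisymmetric.class_translate`);
* `eq_zero_of_screw_anyAxis'` — the same in the original frame: `v(s, c + L R_{κa} L⁻¹(y − c) + a L e₃) = L R_{κa} L⁻¹ v(s, y)`.

So the residue of K2 may assume: invariant under NO screw motion (any pitch) about ANY axis.  WHAT THIS IS NOT: not a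
claim about Navier–Stokes regularity and not the open residue — a settled stratum of it (bears_on LADDER-NS N0).
-/

noncomputable section

-- the summit and its single sub-problem share the name (CONVENTIONS §1), as in every Theorems file
set_option linter.dupNamespace false

namespace Summit.NavierStokesRegularity.NavierStokesRegularity.Theorems.PoloidalWindowDoorPoloidalWindowRigidityScrewAnyAxis

open MeasureTheory Set Function Filter Topology TopologicalSpace Metric
open scoped RealInnerProductSpace InnerProductSpace
open Literature.Analysis Literature.Analysis.FluidPDE
open Summit.NavierStokesRegularity.NavierStokesRegularity.Theorems.LocalSineTubeDoorProfileAlignedWindowRigidityAncient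
open Summit.NavierStokesRegularity.NavierStokesRegularity.Theorems.PoloidalWindowDoorPoloidalWindowRigidityRotate
open Summit.NavierStokesRegularity.NavierStokesRegularity.Theorems.PoloidalWindowDoorPoloidalWindowRigidityAxisymmetric
open Summit.NavierStokesRegularity.NavierStokesRegularity.Theorems.PoloidalWindowDoorPoloidalWindowRigidityStrata
open Summit.NavierStokesRegularity.NavierStokesRegularity.Theorems.PoloidalWindowDoorPoloidalWindowRigidityOneSlice
open Summit.NavierStokesRegularity.NavierStokesRegularity.Theorems.PoloidalWindowDoorPoloidalWindowRigidityAnyAxis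

variable {C : ℝ} {v : ℝ → EuclideanSpace ℝ (Fin 3) → EuclideanSpace ℝ (Fin 3)}

/-! ### vector algebra in the frame of the axis -/

/-- **A vector all of whose rotates about the axis are orthogonal to a fixed non-vertical vector is vertical.** If
`⟪R_θ W, e'⟫ = 0` for every angle `θ`, where `e'` has a nonzero horizontal component, then `W × e₃ = 0`: the three
angles `θ = 0, π, π/2` give `e'₀ W₀ + e'₁ W₁ = 0 = e'₁ W₀ − e'₀ W₁`, whence `W₀ = W₁ = 0`
(cf. `…AnyAxis.cross_single_two_eq_zero_of_isAxisymmetric`, the same computation for an axisymmetric field). -/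
theorem cross_single_two_eq_zero_of_forall_rotZ {W e' : EuclideanSpace ℝ (Fin 3)} (he : e' 0 ≠ 0 ∨ e' 1 ≠ 0)
    (hθ : ∀ θ : ℝ, ⟪rotZ θ W, e'⟫_ℝ = 0) :
    cross W (EuclideanSpace.single 2 1) = 0 := by
  have e0 := hθ 0
  have e1 := hθ Real.pi
  have e2 := hθ (Real.pi / 2)
  simp only [PiLp.inner_apply, RCLike.inner_apply, conj_trivial, Fin.sum_univ_three, rotZ_apply_zero,
    rotZ_apply_one, rotZ_apply_two, Real.cos_zero, Real.sin_zero, Real.cos_pi, Real.sin_pi,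
    Real.cos_pi_div_two, Real.sin_pi_div_two] at e0 e1 e2
  -- the two linear relations
  have l1 : e' 0 * W 0 + e' 1 * W 1 = 0 := by linear_combination (e0 - e1) / 2
  have l2 : e' 1 * W 0 - e' 0 * W 1 = 0 := by linear_combination e2 - (e0 + e1) / 2
  have hq : 0 < e' 0 ^ 2 + e' 1 ^ 2 := by
    rcases he with ha | hb
    · have : 0 < e' 0 ^ 2 := by positivity
      linarith [sq_nonneg (e' 1)]
    · have : 0 < e' 1 ^ 2 := by positivity
      linarith [sq_nonneg (e' 0)]
  have hW0 : W 0 = 0 := by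
    have h3 : (e' 0 ^ 2 + e' 1 ^ 2) * W 0 = 0 := by linear_combination e' 0 * l1 + e' 1 * l2
    exact (mul_eq_zero.1 h3).resolve_left hq.ne'
  have hW1 : W 1 = 0 := by
    have h3 : (e' 0 ^ 2 + e' 1 ^ 2) * W 1 = 0 := by linear_combination e' 1 * l1 - e' 0 * l2
    exact (mul_eq_zero.1 h3).resolve_left hq.ne'
  exact (cross_single_two_eq_zero_iff _).2 ⟨hW0, hW1⟩

/-! ### kinematics of a field invariant under one screw motion -/

/-- **Jacobian of a screw-invariant field.** If a field `w`, differentiable everywhere, is invariant under ONE screw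
motion `S : y ↦ c + R_θ(y − c) + a e₃` (`w (S y) = R_θ (w y)` for all `y`), then `Dw(S y) = R_θ ∘ Dw(y) ∘ R_{−θ}`
(differentiate `w ∘ S = R_θ ∘ w`; `DS = R_θ`). -/
theorem fderiv_screw {w : EuclideanSpace ℝ (Fin 3) → EuclideanSpace ℝ (Fin 3)} (hd : Differentiable ℝ w)
    {θ a : ℝ} {c : EuclideanSpace ℝ (Fin 3)}
    (hinv : ∀ y, w (c + rotZ θ (y - c) + a • EuclideanSpace.single 2 (1 : ℝ)) = rotZ θ (w y))
    (y : EuclideanSpace ℝ (Fin 3)) :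
    fderiv ℝ w (c + rotZ θ (y - c) + a • EuclideanSpace.single 2 (1 : ℝ)) =
      (rotZL θ).comp ((fderiv ℝ w y).comp (rotZL (-θ))) := by
  -- the screw motion as `R_θ y + d`
  set d : EuclideanSpace ℝ (Fin 3) := c - rotZL θ c + a • (EuclideanSpace.single 2 (1 : ℝ) : EuclideanSpace ℝ (Fin 3))
    with hd'
  have hS : ∀ z : EuclideanSpace ℝ (Fin 3),
      c + rotZ θ (z - c) + a • (EuclideanSpace.single 2 (1 : ℝ) : EuclideanSpace ℝ (Fin 3)) = rotZL θ z + d := by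
    intro z
    rw [hd', ← rotZL_apply, map_sub]
    abel
  have hcomp : (fun z => w (rotZL θ z + d)) = fun z => rotZL θ (w z) := by
    funext z
    rw [← hS z, hinv z, rotZL_apply]
  have haff : HasFDerivAt (fun z : EuclideanSpace ℝ (Fin 3) => rotZL θ z + d) (rotZL θ) y :=
    (rotZL θ).hasFDerivAt.add_const d
  have hl : HasFDerivAt (fun z => w (rotZL θ z + d)) ((fderiv ℝ w (rotZL θ y + d)).comp (rotZL θ)) y :=
    (hd (rotZL θ y + d)).hasFDerivAt.comp y haff
  have hr : HasFDerivAt (fun z => rotZL θ (w z)) ((rotZL θ).comp (fderiv ℝ w y)) y :=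
    (rotZL θ).hasFDerivAt.comp y (hd y).hasFDerivAt
  rw [hcomp] at hl
  have heq := hl.unique hr
  rw [hS y]
  calc fderiv ℝ w (rotZL θ y + d)
      = ((fderiv ℝ w (rotZL θ y + d)).comp (rotZL θ)).comp (rotZL (-θ)) := by
          rw [ContinuousLinearMap.comp_assoc, rotZL_comp_neg, ContinuousLinearMap.comp_id]
    _ = ((rotZL θ).comp (fderiv ℝ w y)).comp (rotZL (-θ)) := by rw [heq]
    _ = (rotZL θ).comp ((fderiv ℝ w y).comp (rotZL (-θ))) := by
          rw [ContinuousLinearMap.comp_assoc]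

/-- **The vorticity of a screw-invariant field is screw-equivariant**: under the hypotheses of `fderiv_screw`,
`curl w (S y) = R_θ (curl w y)` (the algebraic equivariance `curlCLM_rotZL_conj` of the tree). -/
theorem curl_screw {w : EuclideanSpace ℝ (Fin 3) → EuclideanSpace ℝ (Fin 3)} (hd : Differentiable ℝ w)
    {θ a : ℝ} {c : EuclideanSpace ℝ (Fin 3)}
    (hinv : ∀ y, w (c + rotZ θ (y - c) + a • EuclideanSpace.single 2 (1 : ℝ)) = rotZ θ (w y))
    (y : EuclideanSpace ℝ (Fin 3)) :
    curl w (c + rotZ θ (y - c) + a • EuclideanSpace.single 2 (1 : ℝ)) = rotZ θ (curl w y) := by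
  rw [curl_eq_curlCLM, curl_eq_curlCLM, fderiv_screw hd hinv y, curlCLM_rotZL_conj]

/-! ### the stratum: a tilted axis, one slice -/

/-- **Poloidal + screw-invariant about a TILTED axis on ONE slice ⇒ trivial.** Let `v` be a profile of the route's
Type-I class, poloidal along `e₃` on every slice.  Suppose that for some linear isometry `L` of `ℝ³` with
`L⁻¹e₃ ∦ e₃` (the axis direction `L e₃` is not vertical), some centre `c`, some pitch `κ` and some `s < 0`, the slice
in the frame of the axis, `u(y) = L⁻¹ v(s, L y + c)`, is invariant under the screw motions of pitch `κ` about the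
`x₃`-axis: `u (R_{κa} y + a e₃) = R_{κa} (u y)` for all `a`, `y`.  Then `v ≡ 0` on the slab.  (For `κ ≠ 0` the
vorticity of `u` is orthogonal to every rotate of `e' = L⁻¹e₃`, hence vertical — `…Strata.eq_zero_of_aligned`; for
`κ = 0` the slice is invariant under the vertical translations — `…OneSlice.eq_zero_of_translate_eq_slice`.) -/
theorem eq_zero_of_screw_tiltedAxis_slice (hrate : HasTypeITimeDecay C v)
    (hcont : ContinuousOn (uncurry v) (Iio (0 : ℝ) ×ˢ univ))
    (hmild : ∀ s t : ℝ, s < t → t < 0 → ∀ x,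
      v t x = UnboundedOperators.heatExtension (v s) (t - s) x - oseenDuhamel 1 s v v t x)
    (hdiv : ∀ t < 0, VectorCalculus.IsDivFree (v t))
    (hpol : ∀ s < 0, ∀ y, ⟪curl (v s) y, EuclideanSpace.single 2 1⟫_ℝ = 0)
    (L : EuclideanSpace ℝ (Fin 3) ≃ₗᵢ[ℝ] EuclideanSpace ℝ (Fin 3)) (c : EuclideanSpace ℝ (Fin 3))
    (htilt : cross (L.symm (EuclideanSpace.single 2 1)) (EuclideanSpace.single 2 1) ≠ 0)
    (κ : ℝ) {s : ℝ} (hs : s < 0)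
    (hscrew : ∀ (a : ℝ) (y : EuclideanSpace ℝ (Fin 3)),
      L.symm (v s (L (rotZ (κ * a) y + a • EuclideanSpace.single 2 (1 : ℝ)) + c)) =
        rotZ (κ * a) (L.symm (v s (L y + c)))) :
    ∀ t < 0, ∀ x, v t x = 0 := by
  -- ## the profile in the frame of the axis: `u(t, y) = L⁻¹ v(t, L y + c)`
  obtain ⟨hrate₁, hcont₁, hmild₁, hdiv₁⟩ := class_translate c hrate hcont hmild hdiv
  obtain ⟨hrate', hcont', hmild', hdiv'⟩ := class_conj_linearIsometryEquiv L.symm hrate₁ hcont₁ hmild₁ hdiv₁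
  simp only [LinearIsometryEquiv.symm_symm] at hrate' hcont' hmild' hdiv'
  set u : ℝ → EuclideanSpace ℝ (Fin 3) → EuclideanSpace ℝ (Fin 3) := fun t y => L.symm (v t (L y + c)) with hu
  -- `u` is poloidal along `e' := L⁻¹ e₃`
  set e' : EuclideanSpace ℝ (Fin 3) := L.symm (EuclideanSpace.single 2 1) with he'
  have hpolu : ∀ σ < 0, ∀ y, ⟪curl (u σ) y, e'⟫_ℝ = 0 := by
    intro σ hσ y
    have h1 := (inner_curl_conj_linearIsometryEquiv_eq_zero_iff L.symm (fun z => v σ (z + c)) y e').2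
    simp only [LinearIsometryEquiv.symm_symm] at h1
    refine h1 ?_
    have hc : curl (fun z => v σ (z + c)) (L y) = curl (v σ) (L y + c) := by
      rw [curl_eq_curlCLM, curl_eq_curlCLM, fderiv_comp_add_right]
    rw [hc, he', LinearIsometryEquiv.apply_symm_apply]
    exact hpol σ hσ (L y + c)
  -- it suffices to show `u ≡ 0`
  suffices hzero : ∀ t < 0, ∀ y, u t y = 0 by
    intro t ht x
    have h := hzero t ht (L.symm (x - c))
    simp only [hu, LinearIsometryEquiv.apply_symm_apply, sub_add_cancel,
      LinearIsometryEquiv.map_eq_zero_iff] at h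
    exact h
  have hbdd' := bdd_of_hasTypeITimeDecay hrate'
  -- the screw invariance of the slice `u s`, in the shape `u (0 + R(y − 0) + a e₃) = R (u y)`
  have hinv : ∀ (a : ℝ) (y : EuclideanSpace ℝ (Fin 3)),
      u s (0 + rotZ (κ * a) (y - 0) + a • EuclideanSpace.single 2 (1 : ℝ)) = rotZ (κ * a) (u s y) := by
    intro a y
    rw [zero_add, sub_zero]
    exact hscrew a y
  have he : e' 0 ≠ 0 ∨ e' 1 ≠ 0 := by
    by_contra hne
    push Not at hne
    exact htilt ((cross_single_two_eq_zero_iff e').2 hne)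
  by_cases hκ : κ = 0
  · -- ## Case κ = 0: the slice is invariant under the vertical translations
    have htr : ∀ (y : EuclideanSpace ℝ (Fin 3)) (l : ℝ),
        u s (y + l • EuclideanSpace.single 2 (1 : ℝ)) = u s y := by
      intro y l
      have h := hinv l y
      rwa [hκ, zero_mul, rotZ_zero, rotZ_zero, zero_add, sub_zero] at h
    have hne : (EuclideanSpace.single 2 1 : EuclideanSpace ℝ (Fin 3)) ≠ 0 := fun h0 => by
      simpa using congrArg (fun w : EuclideanSpace ℝ (Fin 3) => w 2) h0
    exact eq_zero_of_translate_eq_slice hrate' hcont' hmild' hdiv' hs hne htr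
  · -- ## Case κ ≠ 0: the vorticity of the slice is vertical, hence unidirectional
    have hC1 : ContDiff ℝ 1 (u s) := (analyticOnNhd_slice hcont' hbdd' hmild' hs).contDiff
    have hd : Differentiable ℝ (u s) := hC1.differentiable one_ne_zero
    have hal : ∀ y, cross (curl (u s) y) (EuclideanSpace.single 2 1) = 0 := by
      intro y
      refine cross_single_two_eq_zero_of_forall_rotZ he fun θ => ?_
      -- `R_θ (curl u y) = curl u (S_a y)` with `a = θ/κ`
      have h := curl_screw hd (hinv (θ / κ)) y
      rw [mul_div_cancel₀ θ hκ] at h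
      rw [← h]
      exact hpolu s hs _
    have hne : (EuclideanSpace.single 2 1 : EuclideanSpace ℝ (Fin 3)) ≠ 0 := fun h0 => by
      simpa using congrArg (fun w : EuclideanSpace ℝ (Fin 3) => w 2) h0
    exact eq_zero_of_aligned hrate' hcont' hmild' hdiv' hne hs hal

/-! ### the stratum: any axis, every slice -/

/-- **Poloidal + screw-invariant about an ARBITRARY axis on every slice ⇒ trivial.** Let `v` be a profile of the
route's Type-I class, poloidal along `e₃` on every slice.  If for some linear isometry `L` of `ℝ³`, some centre `c`
and some pitch `κ` (any value, `κ = 0` = translations along the axis included), EVERY slice in the frame of the axis,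
`y ↦ L⁻¹ v(s, L y + c)`, is invariant under the screw motions of pitch `κ` about the `x₃`-axis, then `v ≡ 0` on the
slab: a tilted axis by `eq_zero_of_screw_tiltedAxis_slice` (one slice suffices), a vertical axis (`L⁻¹e₃ ∥ e₃`, the
conjugated profile is again poloidal along `e₃`) by the registered stub S1 of the line `slicesharp-screw`
(`…ScrewAssembly.screwStratum_of_L2_L3_L4` with the landed L2 `…ScrewKinematics.stub_screwKinematics`,
L3 `…ScrewPressure.stub_screwPressure`, L4 `…DecayingSlopeLiouville.stub_decayingSlopeLiouville`). -/
theorem eq_zero_of_screw_anyAxis (hrate : HasTypeITimeDecay C v)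
    (hcont : ContinuousOn (uncurry v) (Iio (0 : ℝ) ×ˢ univ))
    (hmild : ∀ s t : ℝ, s < t → t < 0 → ∀ x,
      v t x = UnboundedOperators.heatExtension (v s) (t - s) x - oseenDuhamel 1 s v v t x)
    (hdiv : ∀ t < 0, VectorCalculus.IsDivFree (v t))
    (hpol : ∀ s < 0, ∀ y, ⟪curl (v s) y, EuclideanSpace.single 2 1⟫_ℝ = 0)
    (L : EuclideanSpace ℝ (Fin 3) ≃ₗᵢ[ℝ] EuclideanSpace ℝ (Fin 3)) (c : EuclideanSpace ℝ (Fin 3)) (κ : ℝ)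
    (hscrew : ∀ s < 0, ∀ (a : ℝ) (y : EuclideanSpace ℝ (Fin 3)),
      L.symm (v s (L (rotZ (κ * a) y + a • EuclideanSpace.single 2 (1 : ℝ)) + c)) =
        rotZ (κ * a) (L.symm (v s (L y + c)))) :
    ∀ t < 0, ∀ x, v t x = 0 := by
  by_cases htilt : cross (L.symm (EuclideanSpace.single 2 1)) (EuclideanSpace.single 2 1) ≠ 0
  · -- ## a tilted axis: one slice suffices
    exact eq_zero_of_screw_tiltedAxis_slice hrate hcont hmild hdiv hpol L c htilt κ
      (show (-1 : ℝ) < 0 by norm_num) (hscrew (-1) (by norm_num))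
  · -- ## a vertical axis: S1 in the frame of the axis
    push Not at htilt
    obtain ⟨hrate₁, hcont₁, hmild₁, hdiv₁⟩ := class_translate c hrate hcont hmild hdiv
    obtain ⟨hrate', hcont', hmild', hdiv'⟩ := class_conj_linearIsometryEquiv L.symm hrate₁ hcont₁ hmild₁ hdiv₁
    simp only [LinearIsometryEquiv.symm_symm] at hrate' hcont' hmild' hdiv'
    set u : ℝ → EuclideanSpace ℝ (Fin 3) → EuclideanSpace ℝ (Fin 3) := fun t y => L.symm (v t (L y + c)) with hu
    set e' : EuclideanSpace ℝ (Fin 3) := L.symm (EuclideanSpace.single 2 1) with he'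
    have hpolu : ∀ σ < 0, ∀ y, ⟪curl (u σ) y, e'⟫_ℝ = 0 := by
      intro σ hσ y
      have h1 := (inner_curl_conj_linearIsometryEquiv_eq_zero_iff L.symm (fun z => v σ (z + c)) y e').2
      simp only [LinearIsometryEquiv.symm_symm] at h1
      refine h1 ?_
      have hc : curl (fun z => v σ (z + c)) (L y) = curl (v σ) (L y + c) := by
        rw [curl_eq_curlCLM, curl_eq_curlCLM, fderiv_comp_add_right]
      rw [hc, he', LinearIsometryEquiv.apply_symm_apply]
      exact hpol σ hσ (L y + c)
    suffices hzero : ∀ t < 0, ∀ y, u t y = 0 by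
      intro t ht x
      have h := hzero t ht (L.symm (x - c))
      simp only [hu, LinearIsometryEquiv.apply_symm_apply, sub_add_cancel,
        LinearIsometryEquiv.map_eq_zero_iff] at h
      exact h
    -- `e' ∥ e₃`, so `u` is poloidal along `e₃`
    obtain ⟨he0, he1⟩ := (cross_single_two_eq_zero_iff e').1 htilt
    have he2 : e' 2 ≠ 0 := by
      intro he2
      have hz : e' = 0 := by
        ext i
        fin_cases i
        · exact he0
        · exact he1
        · exact he2
      have hne : (EuclideanSpace.single 2 1 : EuclideanSpace ℝ (Fin 3)) ≠ 0 := fun h0 => by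
        simpa using congrArg (fun w : EuclideanSpace ℝ (Fin 3) => w 2) h0
      exact hne ((LinearIsometryEquiv.map_eq_zero_iff L.symm).1 (he'.symm.trans hz ▸ rfl))
    have hpolu3 : ∀ σ < 0, ∀ y, ⟪curl (u σ) y, EuclideanSpace.single 2 1⟫_ℝ = 0 := by
      intro σ hσ y
      have h1 := hpolu σ hσ y
      have hexp : ⟪curl (u σ) y, e'⟫_ℝ = e' 2 * curl (u σ) y 2 := by
        simp only [PiLp.inner_apply, RCLike.inner_apply, conj_trivial, Fin.sum_univ_three, he0, he1]
        ring
      rw [hexp] at h1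
      have h2 : curl (u σ) y 2 = 0 := (mul_eq_zero.1 h1).resolve_left he2
      simp [EuclideanSpace.inner_single_right, h2]
    -- S1 (the helical stratum about the vertical axis through `0`), assembled from the landed L2, L3, L4
    have hS1 :=
      Summit.NavierStokesRegularity.NavierStokesRegularity.Theorems.PoloidalWindowDoorPoloidalWindowRigidityScrewAssembly.screwStratum_of_L2_L3_L4
        Summit.NavierStokesRegularity.NavierStokesRegularity.Theorems.PoloidalWindowDoorPoloidalWindowRigidityScrewKinematics.stub_screwKinematics
        Summit.NavierStokesRegularity.NavierStokesRegularity.Theorems.PoloidalWindowDoorPoloidalWindowRigidityScrewPressure.stub_screwPressure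
        Summit.NavierStokesRegularity.NavierStokesRegularity.Theorems.PoloidalWindowDoorPoloidalWindowRigidityDecayingSlopeLiouville.stub_decayingSlopeLiouville
    -- the screw invariance of `u`, in the shape `u (0 + R(y − 0) + a e₃) = R (u y)`
    have hinv : ∀ σ < 0, ∀ (a : ℝ) (y : EuclideanSpace ℝ (Fin 3)),
        u σ (0 + rotZ (κ * a) (y - 0) + a • EuclideanSpace.single 2 (1 : ℝ)) = rotZ (κ * a) (u σ y) := by
      intro σ hσ a y
      rw [zero_add, sub_zero]
      exact hscrew σ hσ a y
    by_cases hκ : κ = 0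
    · -- ## pitch `0`: every slice is invariant under the vertical translations
      have htr : ∀ (y : EuclideanSpace ℝ (Fin 3)) (l : ℝ),
          u (-1) (y + l • EuclideanSpace.single 2 (1 : ℝ)) = u (-1) y := by
        intro y l
        have h := hinv (-1) (by norm_num) l y
        rwa [hκ, zero_mul, rotZ_zero, rotZ_zero, zero_add, sub_zero] at h
      have hne : (EuclideanSpace.single 2 1 : EuclideanSpace ℝ (Fin 3)) ≠ 0 := fun h0 => by
        simpa using congrArg (fun w : EuclideanSpace ℝ (Fin 3) => w 2) h0
      exact eq_zero_of_translate_eq_slice hrate' hcont' hmild' hdiv' (show (-1 : ℝ) < 0 by norm_num) hne htr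
    · exact hS1 C u hrate' hcont' hmild' hdiv' hpolu3 ⟨κ, hκ, 0, hinv⟩

/-- **The screw-symmetric stratum about an arbitrary axis is empty**: such a profile is not backward-singular. -/
theorem nonflatLiouville_of_screw_anyAxis (hrate : HasTypeITimeDecay C v)
    (hcont : ContinuousOn (uncurry v) (Iio (0 : ℝ) ×ˢ univ))
    (hmild : ∀ s t : ℝ, s < t → t < 0 → ∀ x,
      v t x = UnboundedOperators.heatExtension (v s) (t - s) x - oseenDuhamel 1 s v v t x)
    (hdiv : ∀ t < 0, VectorCalculus.IsDivFree (v t))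
    (hpol : ∀ s < 0, ∀ y, ⟪curl (v s) y, EuclideanSpace.single 2 1⟫_ℝ = 0)
    (L : EuclideanSpace ℝ (Fin 3) ≃ₗᵢ[ℝ] EuclideanSpace ℝ (Fin 3)) (c : EuclideanSpace ℝ (Fin 3)) (κ : ℝ)
    (hscrew : ∀ s < 0, ∀ (a : ℝ) (y : EuclideanSpace ℝ (Fin 3)),
      L.symm (v s (L (rotZ (κ * a) y + a • EuclideanSpace.single 2 (1 : ℝ)) + c)) =
        rotZ (κ * a) (L.symm (v s (L y + c)))) :
    ¬ IsBackwardSingularPoint v 0 :=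
  Summit.NavierStokesRegularity.NavierStokesRegularity.Theorems.PoloidalWindowDoorPoloidalWindowRigidityFlat.not_backwardSingular_of_zero
    (eq_zero_of_screw_anyAxis hrate hcont hmild hdiv hpol L c κ hscrew)

/-- **The same stratum in the original frame.** The screw motion of pitch `κ` about the axis through `c` with
direction `L e₃` is `y ↦ c + L R_{κa} L⁻¹ (y − c) + a L e₃`, acting on fields by `L R_{κa} L⁻¹`; a profile of the
class, poloidal along `e₃`, all of whose slices are invariant under these motions (`L`, `c`, `κ` fixed, all `a`)
vanishes identically.  For `L = 1` this is the registered stub S1 verbatim (plus the case `κ = 0`). -/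
theorem eq_zero_of_screw_anyAxis' (hrate : HasTypeITimeDecay C v)
    (hcont : ContinuousOn (uncurry v) (Iio (0 : ℝ) ×ˢ univ))
    (hmild : ∀ s t : ℝ, s < t → t < 0 → ∀ x,
      v t x = UnboundedOperators.heatExtension (v s) (t - s) x - oseenDuhamel 1 s v v t x)
    (hdiv : ∀ t < 0, VectorCalculus.IsDivFree (v t))
    (hpol : ∀ s < 0, ∀ y, ⟪curl (v s) y, EuclideanSpace.single 2 1⟫_ℝ = 0)
    (L : EuclideanSpace ℝ (Fin 3) ≃ₗᵢ[ℝ] EuclideanSpace ℝ (Fin 3)) (c : EuclideanSpace ℝ (Fin 3)) (κ : ℝ)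
    (hscrew : ∀ s < 0, ∀ (a : ℝ) (y : EuclideanSpace ℝ (Fin 3)),
      v s (c + L (rotZ (κ * a) (L.symm (y - c))) + a • L (EuclideanSpace.single 2 (1 : ℝ))) =
        L (rotZ (κ * a) (L.symm (v s y)))) :
    ∀ t < 0, ∀ x, v t x = 0 := by
  refine eq_zero_of_screw_anyAxis hrate hcont hmild hdiv hpol L c κ fun s hs a y => ?_
  have h := hscrew s hs a (L y + c)
  rw [add_sub_cancel_right, LinearIsometryEquiv.symm_apply_apply] at h
  have harg : L (rotZ (κ * a) y + a • EuclideanSpace.single 2 (1 : ℝ)) + c =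
      c + L (rotZ (κ * a) y) + a • L (EuclideanSpace.single 2 (1 : ℝ)) := by
    rw [map_add, LinearIsometryEquiv.map_smul]
    abel
  rw [harg, h, LinearIsometryEquiv.symm_apply_apply]

/-- **The vertical special case, any pitch** (S1 plus `κ = 0`): a profile of the class, poloidal along `e₃`, all of
whose slices are invariant under the screw motions `y ↦ c + R_{κa}(y − c) + a e₃` (some `κ`, some `c`, all `a`)
vanishes identically — the registered S1 asks `κ ≠ 0`; `κ = 0` is the vertical-translation stratum. -/
theorem eq_zero_of_screw_vertical_anyPitch (hrate : HasTypeITimeDecay C v)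
    (hcont : ContinuousOn (uncurry v) (Iio (0 : ℝ) ×ˢ univ))
    (hmild : ∀ s t : ℝ, s < t → t < 0 → ∀ x,
      v t x = UnboundedOperators.heatExtension (v s) (t - s) x - oseenDuhamel 1 s v v t x)
    (hdiv : ∀ t < 0, VectorCalculus.IsDivFree (v t))
    (hpol : ∀ s < 0, ∀ y, ⟪curl (v s) y, EuclideanSpace.single 2 1⟫_ℝ = 0)
    (c : EuclideanSpace ℝ (Fin 3)) (κ : ℝ)
    (hscrew : ∀ s < 0, ∀ (a : ℝ) (y : EuclideanSpace ℝ (Fin 3)),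
      v s (c + rotZ (κ * a) (y - c) + a • EuclideanSpace.single 2 (1 : ℝ)) = rotZ (κ * a) (v s y)) :
    ∀ t < 0, ∀ x, v t x = 0 :=
  eq_zero_of_screw_anyAxis' hrate hcont hmild hdiv hpol (LinearIsometryEquiv.refl ℝ _) c κ
    fun s hs a y => by
      change v s (c + rotZ (κ * a) (y - c) + a • EuclideanSpace.single 2 (1 : ℝ)) = rotZ (κ * a) (v s y)
      exact hscrew s hs a y

end Summit.NavierStokesRegularity.NavierStokesRegularity.Theorems.PoloidalWindowDoorPoloidalWindowRigidityScrewAnyAxis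

end
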